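import Literature.NumberTheory.Automorphic.MeyerDifferenceRepresentationProofs
import Literature.NumberTheory.Automorphic.MeyerCommonKernel
import HarnessLib

/-!
# Joint eigenvectors from non-zero algebraic multiplicity (abelian case)

Topic `NumberTheory/Automorphic`; namespace `Literature.NumberTheory.Automorphic`. Companion PROOF
file (theorems only) of `MeyerDifferenceRepresentation`, which defines after R. Meyer, Duke Math.
J. 127 (2005), §2.3 [Meyer2005], for a representation `ρ` of a monoid `G` on a `k`-module `V`:
the spectrum `jointSpectrum ρ` (characters `χ` admitting a joint eigenvector), the joint
generalised eigenspace `jointGenEigenspace ρ χ = ⋂_g ⋃_n ker (ρ g - χ g)ⁿ` and the algebraic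
multiplicity `algMultiplicity ρ χ = sup_W dim (W ⊓ jointGenEigenspace ρ χ)` over the
finite-dimensional invariant subspaces `W`, and proves
`one_le_algMultiplicity_of_mem_jointSpectrum` (a joint eigenvector gives multiplicity `≥ 1`).

This file proves the CONVERSE for commutative `G`:

* `exists_joint_eigenvector_of_inf_jointGenEigenspace_ne_bot` — if a finite-dimensional invariant
  `W` meets the joint generalised eigenspace of `χ` non-trivially, then `W` contains a joint
  EIGENvector `v ≠ 0`, `ρ g v = χ g • v` for all `g` (the commuting family `ρ g - χ g`, locally
  nilpotent on the invariant finite-dimensional `W ⊓ jointGenEigenspace ρ χ ≠ 0`, has a common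
  kernel vector: `Meyer.exists_common_kernel_vector` of `MeyerCommonKernel`);
* `mem_jointSpectrum_of_algMultiplicity_ne_zero` — **non-zero algebraic multiplicity ⟹ `χ` is in
  the spectrum**, and the resulting characterisations `mem_jointSpectrum_iff_algMultiplicity_ne_zero`,
  `mem_jointSpectrum_iff_one_le_algMultiplicity`, `jointSpectrum_eq_setOf_algMultiplicity_ne_zero`.

No algebraic closedness of `k` is needed (the eigenvalues are prescribed by `χ`); commutativity of
`G` is (for `G` non-abelian the joint generalised eigenspace need not be invariant). Used by route
RuelleBand of the Riemann Hypothesis summit to turn the multiplicities of Meyer's Theorem 5.11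
(named fact `Meyer.spectralRealisation_rat`: `mult(|x|^s, π₋) = ord_s Λ`) into the joint
eigenvectors of `π₋` that its Lasota–Yorke landing datum asks for. The definitions are Meyer's
[Meyer2005, §2.3]; the lemma itself is folklore linear algebra. Nothing here is specific to idele
class groups; no definitions, no named facts.

## References

* R. Meyer, *On a representation of the idele class group related to primes and zeros of
  L-functions*, Duke Math. J. 127 (2005), 519–595 = arXiv:math/0311468, §2.3 [Meyer2005].
-/

noncomputable section

namespace Literature.NumberTheory.Automorphic

section Comm

variable {k G V : Type*} [Field k] [CommMonoid G] [AddCommGroup V] [Module k V]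

/-- For commutative `G` the operators `ρ g - χ g • 1`, `g ∈ G`, pairwise commute. [folklore] -/
theorem commute_rep_sub_smul_one (ρ : Representation k G V) (χ : G → k) (g h : G) :
    Commute (ρ g - χ g • (1 : Module.End k V)) (ρ h - χ h • (1 : Module.End k V)) := by
  have hc : Commute (ρ g) (ρ h) := by
    change ρ g * ρ h = ρ h * ρ g
    rw [← map_mul, ← map_mul, mul_comm]
  exact (hc.sub_left (Commute.smul_left (Commute.one_left _) _)).sub_right
    (Commute.smul_right (Commute.one_right _) _)

/-- **A finite-dimensional invariant subspace meeting the joint generalised eigenspace of `χ`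
contains a joint eigenvector for `χ`** (commutative `G`): if `W` is finite-dimensional,
`ρ(G)`-invariant and `W ⊓ jointGenEigenspace ρ χ ≠ 0`, there is `0 ≠ v ∈ W ⊓ jointGenEigenspace ρ χ`
with `ρ g v = χ g • v` for every `g`. Proof: `W ⊓ jointGenEigenspace ρ χ` is invariant under the
commuting family `ρ g - χ g • 1` (the joint generalised eigenspace is invariant because `G` is
commutative), each member of which is locally nilpotent on it; such a family has a common kernel
vector (`Meyer.exists_common_kernel_vector`). [folklore] -/
theorem exists_joint_eigenvector_of_inf_jointGenEigenspace_ne_bot (ρ : Representation k G V)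
    (χ : G → k) (W : Submodule k V) [FiniteDimensional k W] (hW : ∀ g : G, W ≤ W.comap (ρ g))
    (hne : W ⊓ jointGenEigenspace ρ χ ≠ ⊥) :
    ∃ v ∈ W ⊓ jointGenEigenspace ρ χ, v ≠ 0 ∧ ∀ g : G, ρ g v = χ g • v := by
  have hinv : ∀ g : G, W ⊓ jointGenEigenspace ρ χ ≤
      (W ⊓ jointGenEigenspace ρ χ).comap (ρ g - χ g • (1 : Module.End k V)) := by
    intro g v hv
    rw [Submodule.mem_comap, LinearMap.sub_apply, LinearMap.smul_apply, Module.End.one_apply]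
    exact Submodule.sub_mem _ ⟨hW g hv.1, jointGenEigenspace_le_comap ρ χ g hv.2⟩
      (Submodule.smul_mem _ _ hv)
  have hnil : ∀ g : G, ∀ v ∈ W ⊓ jointGenEigenspace ρ χ, ∃ n : ℕ,
      ((ρ g - χ g • (1 : Module.End k V)) ^ n) v = 0 :=
    fun g v hv => (mem_jointGenEigenspace_iff ρ χ v).mp hv.2 g
  obtain ⟨v, hv, hv0, hTv⟩ := Meyer.exists_common_kernel_vector
    (fun g : G => ρ g - χ g • (1 : Module.End k V)) (commute_rep_sub_smul_one ρ χ)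
    (W ⊓ jointGenEigenspace ρ χ) inferInstance hinv hnil hne
  refine ⟨v, hv, hv0, fun g => ?_⟩
  have h := hTv g
  simp only [LinearMap.sub_apply, LinearMap.smul_apply, Module.End.one_apply, sub_eq_zero] at h
  exact h

/-- **Non-zero algebraic multiplicity gives a joint eigenvector** (commutative `G`; converse of
`one_le_algMultiplicity_of_mem_jointSpectrum`): if `mult(χ, ρ) ≠ 0` then `χ ∈ jointSpectrum ρ`,
i.e. some `v ≠ 0` satisfies `ρ g v = χ g • v` for all `g ∈ G`. No hypothesis on the field `k`.
[folklore] -/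
theorem mem_jointSpectrum_of_algMultiplicity_ne_zero (ρ : Representation k G V) (χ : G → k)
    (h : algMultiplicity ρ χ ≠ 0) : χ ∈ jointSpectrum ρ := by
  obtain ⟨W, hfin, hW, hne⟩ : ∃ W : Submodule k V, FiniteDimensional k W ∧
      (∀ g : G, W ≤ W.comap (ρ g)) ∧ W ⊓ jointGenEigenspace ρ χ ≠ ⊥ := by
    by_contra hcon
    push Not at hcon
    exact h ((algMultiplicity_eq_zero_iff_forall ρ χ).mpr hcon)
  haveI := hfin
  obtain ⟨v, -, hv0, hv⟩ := exists_joint_eigenvector_of_inf_jointGenEigenspace_ne_bot ρ χ W hW hne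
  exact ⟨v, hv0, hv⟩

/-- For commutative `G`: `χ ∈ jointSpectrum ρ ↔ mult(χ, ρ) ≠ 0`. [folklore] -/
theorem mem_jointSpectrum_iff_algMultiplicity_ne_zero (ρ : Representation k G V) (χ : G → k) :
    χ ∈ jointSpectrum ρ ↔ algMultiplicity ρ χ ≠ 0 :=
  ⟨fun hχ h0 => not_mem_jointSpectrum_of_algMultiplicity_eq_zero h0 hχ,
    mem_jointSpectrum_of_algMultiplicity_ne_zero ρ χ⟩

/-- For commutative `G`: `χ ∈ jointSpectrum ρ ↔ 1 ≤ mult(χ, ρ)`. [folklore] -/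
theorem mem_jointSpectrum_iff_one_le_algMultiplicity (ρ : Representation k G V) (χ : G → k) :
    χ ∈ jointSpectrum ρ ↔ 1 ≤ algMultiplicity ρ χ := by
  rw [mem_jointSpectrum_iff_algMultiplicity_ne_zero, Order.one_le_iff_ne_zero]

/-- For commutative `G` the spectrum is the support of the algebraic multiplicity:
`jointSpectrum ρ = {χ | mult(χ, ρ) ≠ 0}`. [folklore] -/
theorem jointSpectrum_eq_setOf_algMultiplicity_ne_zero (ρ : Representation k G V) :
    jointSpectrum ρ = {χ | algMultiplicity ρ χ ≠ 0} :=
  Set.ext fun χ => mem_jointSpectrum_iff_algMultiplicity_ne_zero ρ χ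

/-- For commutative `G`: a character of positive natural multiplicity `n ≤ mult(χ, ρ)`, `n ≠ 0`
(the shape in which Meyer's Theorem 5.11 delivers `mult(|x|^s, π₋) = ord_s Λ ≥ 1` at a zero `s`
of `Λ`) admits a joint eigenvector. [folklore] -/
theorem exists_joint_eigenvector_of_le_algMultiplicity (ρ : Representation k G V) (χ : G → k)
    {n : ℕ∞} (hn : n ≠ 0) (hle : n ≤ algMultiplicity ρ χ) :
    ∃ v : V, v ≠ 0 ∧ ∀ g : G, ρ g v = χ g • v :=
  mem_jointSpectrum_of_algMultiplicity_ne_zero ρ χ fun h0 => hn (nonpos_iff_eq_zero.mp (h0 ▸ hle))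

end Comm

end Literature.NumberTheory.Automorphic
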